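import Summits.CriticalPhenomena.PercolationContinuityZ3.Theorems.PercNearOneGluingNoHeavyLowerTailSwitchRelaxSemantics
import HarnessLib

/-!
# `NoHeavyLowerTail` (stmt-CriticalPhenomena-4575) — the FINITE RELAXATION of three-copy switching certificates, II:
# certificates as data, the kernel checker, and its SOUNDNESS (check ⇒ pointwise `S ≤ 0` on every finite graph)

Support file (prover prim-cert-2 gen 11; `--supports stmt-CriticalPhenomena-4575`).  No named facts, no sorries.

A certificate (`Cert`) is: a list `RS` of root index sets (the explored unions whose avoidance types the potentials
read), a list of programs of the pool X2 — `U→Y` (`psi1`), `U→Z` (`psi2`), `U→Y; v→Z` (`psi3`), `U→Z; v→Y` (`psi4`) —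
each with an integer potential `λ_p(type o_Y, type o_Z)`, and `λ₀(type X, type Y, type Z)`.  Its value at a
configuration triple `x` of a finite graph with terminals `τ` is `Sreal c τ x = λ₀ + Σ_p λ_p` (`Prog.out` = the tree's
switching maps `GroupThreePointLB.psi1..4`).

THE CHECK (`Cert.check`, evaluated by `decide +kernel` in certificate files).  For every input type `πX`: enumerate
the abstract per-copy states `(t, (p_U)_{U ∈ RS})` — `t` a type, `p_U` a type refining `t` (the type of `T ∖ touch W_U`),
subject to the root-block rule and to monotonicity between comparable masks (`okLocal`, `genStates`) —, map each state
to its SIGNATURE (its type and, per program, the list of admissible output types of part I: `admClean` / `admMessy` /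
the copy's own type), deduplicate, and require `λ₀(πX,t_Y,t_Z) + Σ_p max_{admissible} λ_p ≤ 0` over all signature pairs.

SOUNDNESS (`Cert.sound`): `c.check = true → Sreal c τ x ≤ 0` for every finite `V`, `τ : Fin 4 → V`, `x`.  Proof: the
real states are valid (part I: `refines_ftype_of_subset`, `rootBlock_ftype`, `clS_roots_subset_of_mask`), hence
generated (`genStates_complete`); the real output types are admissible (`admClean_ftype`, `admMessy_ftype`, `psi*_one/_two`);
so the real summands are bounded by the maxima the check controls.
-/

noncomputable section

namespace Summit.CriticalPhenomena.PercolationContinuityZ3.Theorems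

namespace SwitchRelax

open Finset Literature.Probability.Percolation Literature.Probability.Percolation.DecisionTree
open Literature.Probability.Percolation.Gladkov ThreePointLB GroupThreePointLB FourPointAtoms
open scoped Classical

/-! ### Certificates as data -/

/-- A program of pool X2 with its potential: `kind = 0: U→Y`, `1: U→Z`, `2: U→Y; v→Z`, `3: U→Z; v→Y`; `iU`, `iV` are the
positions of `U` and `{v}` in the certificate's root-set list. [this work] -/
structure Prog where
  /-- kind of program -/
  kind : Fin 4
  /-- first (sealed) root set -/
  U : Finset (Fin 4)
  /-- its index in `RS` -/
  iU : ℕ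
  /-- second root (kinds 2, 3) -/
  v : Fin 4
  /-- index of `{v}` in `RS` (kinds 2, 3) -/
  iV : ℕ
  /-- potential on (type of output copy `Y`, type of output copy `Z`) -/
  lam : Ty → Ty → ℤ

/-- A three-copy switching certificate with pair potentials and an input potential. [this work] -/
structure Cert where
  /-- root index sets whose avoidance types are recorded in a state -/
  RS : List (Finset (Fin 4))
  /-- programs -/
  progs : List Prog
  /-- input potential `λ₀(type X, type Y, type Z)` -/
  lam0 : Ty → Ty → Ty → ℤ

/-- Well-formedness: the root sets named by the programs sit at the recorded positions of `RS`. [this work] -/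
def Cert.wf (c : Cert) : Bool :=
  c.progs.all fun p => decide (c.RS[p.iU]? = some p.U) && (decide (p.kind.val < 2) || decide (c.RS[p.iV]? = some {p.v}))

/-! ### States, local validity, generation -/

/-- Masks compare: every terminal `πX`-joined to `U` is `πX`-joined to `U'`. [this work] -/
def maskLE (πX : Ty) (U U' : Finset (Fin 4)) : Bool := decide (∀ i : Fin 4, inW πX U i = true → inW πX U' i = true)
/-- Root-block rule for `(U, p)`: inside the mask of `U`, `p`-blocks lie in `πX`-blocks. [this work] -/
def rootOK (πX : Ty) (U : Finset (Fin 4)) (p : Ty) : Bool :=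
  decide (∀ i j : Fin 4, inW πX U i = true → jn p i j = true → jn πX i j = true)

/-- Monotonicity against the already fixed `(U', p')`. [this work] -/
def pairOK (πX : Ty) (U : Finset (Fin 4)) (p : Ty) : List (Finset (Fin 4)) → List Ty → Bool
  | U' :: RS', p' :: ps' =>
    (!maskLE πX U U' || refines p' p) && (!maskLE πX U' U || refines p p') && pairOK πX U p RS' ps'
  | _, _ => true

/-- Local validity of the next avoidance type `p` for root set `U`. [this work] -/
def okLocal (πX t : Ty) (RSd : List (Finset (Fin 4))) (psd : List Ty) (U : Finset (Fin 4)) (p : Ty) : Bool :=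
  refines p t && rootOK πX U p && pairOK πX U p RSd psd

/-- The list of all 15 types. [folklore] -/
def allTys : List Ty := [0, 1, 2, 3, 4, 5, 6, 7, 8, 9, 10, 11, 12, 13, 14]
/-- Every type is in `allTys`. [folklore] -/
theorem mem_allTys (t : Ty) : t ∈ allTys := by fin_cases t <;> decide
/-- Generate all locally valid tuples of avoidance types for the remaining root sets. [this work] -/
def genStates (πX t : Ty) : List (Finset (Fin 4)) → List Ty → List (Finset (Fin 4)) → List (List Ty)
  | _, _, [] => [[]]
  | RSd, psd, U :: rest =>
    allTys.flatMap fun p =>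
      if okLocal πX t RSd psd U p then (genStates πX t (RSd ++ [U]) (psd ++ [p]) rest).map (fun l => p :: l) else []

/-- Validity of a tuple, in the same recursive shape as the generator. [this work] -/
def validRec (πX t : Ty) : List (Finset (Fin 4)) → List Ty → List (Finset (Fin 4)) → List Ty → Bool
  | _, _, [], [] => true
  | RSd, psd, U :: rest, p :: ps => okLocal πX t RSd psd U p && validRec πX t (RSd ++ [U]) (psd ++ [p]) rest ps
  | _, _, _, _ => false

/-- **Completeness of the generator**: every valid tuple is generated. [this work] -/
theorem genStates_complete (πX t : Ty) :
    ∀ (rest : List (Finset (Fin 4))) (RSd : List (Finset (Fin 4))) (psd ps : List Ty),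
      validRec πX t RSd psd rest ps = true → ps ∈ genStates πX t RSd psd rest
  | [], RSd, psd, ps, h => by
    cases ps with
    | nil => simp [genStates]
    | cons _ _ => simp [validRec] at h
  | U :: rest, RSd, psd, ps, h => by
    cases ps with
    | nil => simp [validRec] at h
    | cons p ps =>
      simp only [validRec, Bool.and_eq_true] at h
      simp only [genStates, List.mem_flatMap]
      refine ⟨p, mem_allTys p, ?_⟩
      rw [if_pos h.1, List.mem_map]
      exact ⟨ps, genStates_complete πX t rest _ _ ps h.2, rfl⟩

/-! ### Signatures -/

/-- A per-copy state: the copy's type and the avoidance types aligned with `RS`. [this work] -/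
abbrev St := Ty × List Ty
/-- Lookup of the avoidance type at position `i`. [this work] -/
def St.p (s : St) (i : ℕ) : Ty := (s.2[i]?).getD 0
/-- Admissible output types of copy `Y` under program `p`, given the abstract state `s` of copy `Y`. [this work] -/
def admY (πX : Ty) (p : Prog) (s : St) (q : Ty) : Bool :=
  match p.kind with
  | 0 => admClean πX (inW πX p.U) (s.p p.iU) q
  | 1 => decide (q = s.1)
  | 2 => admClean πX (inW πX p.U) (s.p p.iU) q
  | 3 => admMessy πX (inW πX p.U) p.v s.1 (s.p p.iV) q

/-- Admissible output types of copy `Z` under program `p`, given the abstract state `s` of copy `Z`. [this work] -/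
def admZ (πX : Ty) (p : Prog) (s : St) (q : Ty) : Bool :=
  match p.kind with
  | 0 => decide (q = s.1)
  | 1 => admClean πX (inW πX p.U) (s.p p.iU) q
  | 2 => admMessy πX (inW πX p.U) p.v s.1 (s.p p.iV) q
  | 3 => admClean πX (inW πX p.U) (s.p p.iU) q

/-- A signature: the copy's type and, per program, the admissible output types. [this work] -/
abbrev Sig := Ty × List (List Ty)
/-- Signature of a state in the role of copy `Y`. [this work] -/
def sigY (c : Cert) (πX : Ty) (s : St) : Sig := (s.1, c.progs.map fun p => allTys.filter (admY πX p s))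
/-- Signature of a state in the role of copy `Z`. [this work] -/
def sigZ (c : Cert) (πX : Ty) (s : St) : Sig := (s.1, c.progs.map fun p => allTys.filter (admZ πX p s))

/-- Insert if not already present. [folklore] -/
def insNew (a : Sig) (l : List Sig) : List Sig := if a ∈ l then l else a :: l
/-- Remove duplicates. [folklore] -/
def dedup : List Sig → List Sig
  | [] => []
  | a :: l => insNew a (dedup l)
/-- `dedup` preserves membership. [folklore] -/
theorem mem_dedup {a : Sig} : ∀ {l : List Sig}, a ∈ l → a ∈ dedup l
  | [], h => h
  | b :: l, h => by
    simp only [dedup, insNew]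
    rcases List.mem_cons.1 h with rfl | h
    · split_ifs with hb
      · exact hb
      · exact List.mem_cons_self
    · split_ifs
      · exact mem_dedup h
      · exact List.mem_cons_of_mem _ (mem_dedup h)

/-! ### Potentials given by entry lists -/

/-- Value at `(s,t)` of a table given by an entry list (sum of the matching entries); certificate files DEFINE their
pair potentials this way. [folklore] -/
def lookup2 (l : List (Ty × Ty × ℤ)) (s t : Ty) : ℤ := (l.map fun e => if e.1 = s ∧ e.2.1 = t then e.2.2 else 0).sum

/-- Value at `(r,s,t)` of a table given by an entry list (input potentials). [folklore] -/
def lookup3 (l : List (Ty × Ty × Ty × ℤ)) (r s t : Ty) : ℤ :=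
  (l.map fun e => if e.1 = r ∧ e.2.1 = s ∧ e.2.2.1 = t then e.2.2.2 else 0).sum

/-! ### Values and the check -/

/-- A lower sentinel for maxima over (never actually) empty lists. [folklore] -/
def bot : ℤ := -(2 ^ 62)
/-- A member of a list is at most its `foldr max`. [folklore] -/
theorem le_foldr_max {x : ℤ} : ∀ {L : List ℤ} (b : ℤ), x ∈ L → x ≤ L.foldr max b
  | [], _, h => absurd h List.not_mem_nil
  | y :: L, b, h => by
    rw [List.foldr_cons]
    rcases List.mem_cons.1 h with rfl | h
    · exact le_max_left _ _
    · exact le_trans (le_foldr_max b h) (le_max_right _ _)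

/-- `max` of the potential over the admissible pairs (`bot` if there are none). [this work] -/
def best (lam : Ty → Ty → ℤ) (ly lz : List Ty) : ℤ :=
  (ly.flatMap fun q => lz.map fun q' => lam q q').foldr max bot

/-- `best` bounds every admissible value. [this work] -/
theorem le_best (lam : Ty → Ty → ℤ) {ly lz : List Ty} {q q' : Ty} (hq : q ∈ ly) (hq' : q' ∈ lz) :
    lam q q' ≤ best lam ly lz :=
  le_foldr_max bot (List.mem_flatMap.2 ⟨q, hq, List.mem_map.2 ⟨q', hq', rfl⟩⟩)

/-- `Σ_p max_{admissible} λ_p` along aligned lists (programs, `Y`-lists, `Z`-lists). [this work] -/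
def sumBest : List Prog → List (List Ty) → List (List Ty) → ℤ
  | p :: ps, ly :: lys, lz :: lzs => best p.lam ly lz + sumBest ps lys lzs
  | _, _, _ => 0

/-- Value of a signature pair. [this work] -/
def valS (c : Cert) (πX : Ty) (a b : Sig) : ℤ := c.lam0 πX a.1 b.1 + sumBest c.progs a.2 b.2
/-- All locally valid states for input type `πX`. [this work] -/
def Cert.states (c : Cert) (πX : Ty) : List St :=
  allTys.flatMap fun t => (genStates πX t [] [] c.RS).map fun ps => (t, ps)

/-- The check at one input type: every pair of (deduplicated) signatures has value `≤ 0`. [this work] -/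
def Cert.checkAt (c : Cert) (πX : Ty) : Bool :=
  let LY := dedup ((c.states πX).map (sigY c πX))
  let LZ := dedup ((c.states πX).map (sigZ c πX))
  LY.all fun a => LZ.all fun b => decide (valS c πX a b ≤ 0)

/-- **THE CHECK**: well-formedness and `checkAt` for all 15 input types. [this work] -/
def Cert.check (c : Cert) : Bool := c.wf && allTys.all fun πX => c.checkAt πX

/-- Assembling `check` from its sixteen kernel-evaluated pieces (one declaration each keeps the kernel's memory per
declaration small). [this work] -/
theorem Cert.check_of_pieces (c : Cert) (hwf : c.wf = true) (h0 : c.checkAt 0 = true) (h1 : c.checkAt 1 = true)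
    (h2 : c.checkAt 2 = true) (h3 : c.checkAt 3 = true) (h4 : c.checkAt 4 = true) (h5 : c.checkAt 5 = true)
    (h6 : c.checkAt 6 = true) (h7 : c.checkAt 7 = true) (h8 : c.checkAt 8 = true) (h9 : c.checkAt 9 = true)
    (h10 : c.checkAt 10 = true) (h11 : c.checkAt 11 = true) (h12 : c.checkAt 12 = true) (h13 : c.checkAt 13 = true)
    (h14 : c.checkAt 14 = true) : c.check = true := by
  simp only [Cert.check, hwf, allTys, List.all_cons, List.all_nil, h0, h1, h2, h3, h4, h5, h6, h7, h8, h9, h10, h11, h12,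
    h13, h14, Bool.and_self]

/-! ### The real value of a certificate -/

section Real

variable {V : Type*} [Fintype V] [DecidableEq V] (τ : Fin 4 → V)

/-- The output triple of program `p` (the tree's switching maps `psi1 … psi4` of `…GroupThreePointLBMaps`). [this work] -/
def Prog.out (p : Prog) (x : Fin 3 → Finset (Sym2 V)) : Fin 3 → Finset (Sym2 V) :=
  match p.kind with
  | 0 => psi1 (roots τ p.U) x
  | 1 => psi2 (roots τ p.U) x
  | 2 => psi3 (roots τ p.U) (roots τ {p.v}) x
  | 3 => psi4 (roots τ p.U) (roots τ {p.v}) x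

/-- `Σ_p λ_p(type o_Y, type o_Z)` over a program list. [this work] -/
def sumLam (x : Fin 3 → Finset (Sym2 V)) : List Prog → ℤ
  | [] => 0
  | p :: ps => p.lam (ftype τ (p.out τ x 1)) (ftype τ (p.out τ x 2)) + sumLam x ps

/-- **The real value** `S(x) = λ₀(type X, type Y, type Z) + Σ_p λ_p(type (Φ_p x)_Y, type (Φ_p x)_Z)`. [this work] -/
def Sreal (c : Cert) (x : Fin 3 → Finset (Sym2 V)) : ℤ :=
  c.lam0 (ftype τ (x 0)) (ftype τ (x 1)) (ftype τ (x 2)) + sumLam τ x c.progs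

/-! ### Soundness -/

/-- The avoidance type of copy `T` for root set `U`. [this work] -/
def realP (X T : Finset (Sym2 V)) (U : Finset (Fin 4)) : Ty := ftype τ (T \ touch (clS X (roots τ U)))
/-- The real abstract state of copy `T`. [this work] -/
def realSt (c : Cert) (X T : Finset (Sym2 V)) : St := (ftype τ T, c.RS.map (realP τ X T))

/-- `pairOK` holds for the real avoidance types (monotonicity in the explored set). [this work] -/
theorem pairOK_real (X T : Finset (Sym2 V)) (U : Finset (Fin 4)) :
    ∀ RSd : List (Finset (Fin 4)), pairOK (ftype τ X) U (realP τ X T U) RSd (RSd.map (realP τ X T)) = true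
  | [] => rfl
  | U' :: RSd => by
    simp only [List.map_cons, pairOK, Bool.and_eq_true, Bool.or_eq_true, Bool.not_eq_true']
    refine ⟨⟨?_, ?_⟩, pairOK_real X T U RSd⟩
    · by_cases h : maskLE (ftype τ X) U U' = true
      · refine Or.inr (refines_ftype_of_subset τ (Finset.sdiff_subset_sdiff subset_rfl (touch_mono ?_)))
        exact clS_roots_subset_of_mask τ (of_decide_eq_true h)
      · exact Or.inl (by simpa using h)
    · by_cases h : maskLE (ftype τ X) U' U = true
      · refine Or.inr (refines_ftype_of_subset τ (Finset.sdiff_subset_sdiff subset_rfl (touch_mono ?_)))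
        exact clS_roots_subset_of_mask τ (of_decide_eq_true h)
      · exact Or.inl (by simpa using h)

/-- `okLocal` holds for the real avoidance types. [this work] -/
theorem okLocal_real (X T : Finset (Sym2 V)) (RSd : List (Finset (Fin 4))) (U : Finset (Fin 4)) :
    okLocal (ftype τ X) (ftype τ T) RSd (RSd.map (realP τ X T)) U (realP τ X T U) = true := by
  simp only [okLocal, Bool.and_eq_true]
  refine ⟨⟨refines_ftype_of_subset τ Finset.sdiff_subset, ?_⟩, pairOK_real τ X T U RSd⟩
  rw [rootOK, decide_eq_true_iff]
  exact fun i j hi hij => rootBlock_ftype τ X T U i j hi hij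

/-- The real state is valid. [this work] -/
theorem validRec_real (X T : Finset (Sym2 V)) :
    ∀ (rest RSd : List (Finset (Fin 4))),
      validRec (ftype τ X) (ftype τ T) RSd (RSd.map (realP τ X T)) rest (rest.map (realP τ X T)) = true
  | [], _ => rfl
  | U :: rest, RSd => by
    simp only [List.map_cons, validRec, Bool.and_eq_true]
    refine ⟨okLocal_real τ X T RSd U, ?_⟩
    have h := validRec_real X T rest (RSd ++ [U])
    rwa [List.map_append, List.map_singleton] at h

/-- The real state is among the generated states. [this work] -/
theorem realSt_mem_states (c : Cert) (X T : Finset (Sym2 V)) : realSt τ c X T ∈ c.states (ftype τ X) := by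
  simp only [Cert.states, List.mem_flatMap, List.mem_map, realSt]
  refine ⟨ftype τ T, mem_allTys _, c.RS.map (realP τ X T), ?_, rfl⟩
  have h := validRec_real τ X T c.RS []
  exact genStates_complete _ _ _ _ _ _ h

/-- Lookup in the real state. [this work] -/
theorem realSt_p (c : Cert) (X T : Finset (Sym2 V)) {i : ℕ} {U : Finset (Fin 4)} (h : c.RS[i]? = some U) :
    (realSt τ c X T).p i = realP τ X T U := by
  simp [St.p, realSt, List.getElem?_map, h]

/-- **The real output types are admissible** (copy `Y`). [this work] -/
theorem admY_real (c : Cert) (p : Prog) (hU : c.RS[p.iU]? = some p.U)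
    (hV : p.kind.val < 2 ∨ c.RS[p.iV]? = some {p.v}) (x : Fin 3 → Finset (Sym2 V)) :
    admY (ftype τ (x 0)) p (realSt τ c (x 0) (x 1)) (ftype τ (p.out τ x 1)) = true := by
  have h0 := realSt_p τ c (x 0) (x 1) hU
  match hk : p.kind with
  | 0 =>
    simp only [admY, hk, Prog.out, psi1_one, h0]
    exact admClean_ftype τ (x 0) (x 1) p.U
  | 1 =>
    simp only [admY, hk, Prog.out, psi2_one, decide_eq_true_iff]; rfl
  | 2 =>
    simp only [admY, hk, Prog.out, psi3_one, h0]
    exact admClean_ftype τ (x 0) (x 1) p.U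
  | 3 =>
    have hV' : c.RS[p.iV]? = some {p.v} := by
      rcases hV with hV | hV
      · rw [hk] at hV; exact absurd hV (by decide)
      · exact hV
    have h1 := realSt_p τ c (x 0) (x 1) hV'
    simp only [admY, hk, Prog.out, psi4_one, h1]
    exact admMessy_ftype τ (x 0) (x 1) p.U p.v

/-- **The real output types are admissible** (copy `Z`). [this work] -/
theorem admZ_real (c : Cert) (p : Prog) (hU : c.RS[p.iU]? = some p.U)
    (hV : p.kind.val < 2 ∨ c.RS[p.iV]? = some {p.v}) (x : Fin 3 → Finset (Sym2 V)) :
    admZ (ftype τ (x 0)) p (realSt τ c (x 0) (x 2)) (ftype τ (p.out τ x 2)) = true := by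
  have h0 := realSt_p τ c (x 0) (x 2) hU
  match hk : p.kind with
  | 0 =>
    simp only [admZ, hk, Prog.out, psi1_two, decide_eq_true_iff]; rfl
  | 1 =>
    simp only [admZ, hk, Prog.out, psi2_two, h0]
    exact admClean_ftype τ (x 0) (x 2) p.U
  | 2 =>
    have hV' : c.RS[p.iV]? = some {p.v} := by
      rcases hV with hV | hV
      · rw [hk] at hV; exact absurd hV (by decide)
      · exact hV
    have h1 := realSt_p τ c (x 0) (x 2) hV'
    simp only [admZ, hk, Prog.out, psi3_two, h1]
    exact admMessy_ftype τ (x 0) (x 2) p.U p.v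
  | 3 =>
    simp only [admZ, hk, Prog.out, psi4_two, h0]
    exact admClean_ftype τ (x 0) (x 2) p.U

/-- The real sum of potentials is bounded by `sumBest` at the real signatures. [this work] -/
theorem sumLam_le_sumBest (c : Cert) (x : Fin 3 → Finset (Sym2 V)) :
    ∀ progs : List Prog, (∀ p ∈ progs, c.RS[p.iU]? = some p.U ∧ (p.kind.val < 2 ∨ c.RS[p.iV]? = some {p.v})) →
      sumLam τ x progs ≤ sumBest progs
        (progs.map fun p => allTys.filter (admY (ftype τ (x 0)) p (realSt τ c (x 0) (x 1))))
        (progs.map fun p => allTys.filter (admZ (ftype τ (x 0)) p (realSt τ c (x 0) (x 2))))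
  | [], _ => le_rfl
  | p :: progs, h => by
    simp only [sumLam, List.map_cons, sumBest]
    have hp := h p List.mem_cons_self
    refine add_le_add (le_best p.lam ?_ ?_) (sumLam_le_sumBest c x progs fun q hq => h q (List.mem_cons_of_mem _ hq))
    · exact List.mem_filter.2 ⟨mem_allTys _, admY_real τ c p hp.1 hp.2 x⟩
    · exact List.mem_filter.2 ⟨mem_allTys _, admZ_real τ c p hp.1 hp.2 x⟩

/-- **SOUNDNESS OF THE FINITE RELAXATION.**  If the kernel check of a certificate passes, its value is `≤ 0` at
every configuration triple of every finite graph, for every placement of the four terminals. [this work] -/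
theorem Cert.sound (c : Cert) (hc : c.check = true) (x : Fin 3 → Finset (Sym2 V)) : Sreal τ c x ≤ 0 := by
  simp only [Cert.check, Bool.and_eq_true, List.all_eq_true] at hc
  obtain ⟨hwf, hall⟩ := hc
  have hπ := hall (ftype τ (x 0)) (mem_allTys _)
  simp only [Cert.checkAt, List.all_eq_true, decide_eq_true_iff] at hπ
  have hY : sigY c (ftype τ (x 0)) (realSt τ c (x 0) (x 1)) ∈
      dedup ((c.states (ftype τ (x 0))).map (sigY c (ftype τ (x 0)))) :=
    mem_dedup (List.mem_map.2 ⟨_, realSt_mem_states τ c (x 0) (x 1), rfl⟩)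
  have hZ : sigZ c (ftype τ (x 0)) (realSt τ c (x 0) (x 2)) ∈
      dedup ((c.states (ftype τ (x 0))).map (sigZ c (ftype τ (x 0)))) :=
    mem_dedup (List.mem_map.2 ⟨_, realSt_mem_states τ c (x 0) (x 2), rfl⟩)
  have hv := hπ _ hY _ hZ
  have hprogs : ∀ p ∈ c.progs, c.RS[p.iU]? = some p.U ∧ (p.kind.val < 2 ∨ c.RS[p.iV]? = some {p.v}) := by
    intro p hp
    simp only [Cert.wf, List.all_eq_true, Bool.and_eq_true, Bool.or_eq_true, decide_eq_true_iff] at hwf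
    exact hwf p hp
  have hle := sumLam_le_sumBest τ c x c.progs hprogs
  simp only [valS, sigY, sigZ, realSt] at hv
  simp only [Sreal, ge_iff_le]
  simp only [realSt] at hle
  linarith

end Real

end SwitchRelax

end Summit.CriticalPhenomena.PercolationContinuityZ3.Theorems

end
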